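import Summits.CriticalPhenomena.PercolationContinuityZ3.Theorems.Transplant.SkelPhiStepINegOrient
import HarnessLib

/-!
# N1 (the `{±1}` node), kit constants under orientation ((L3)/(R6c) helper): THE COMPARISON RADII DO NOT SEE THE ORIENTATION —
# `cylRad`/`cylRadMax` are functions of the cylinders `cyl φ t ℓ`, which coincide for `φ` and its transpose `trφ φ` (`cyl_trφ`), hence for every oriented map
# `oriφ φ b`: `Skelφ.cylRad_trφ`, `cylRadMax_trφ`, `cylRadMax_oriφ`.  Consequence: the ledger's apron radius `R'_P := cylRadMax G Φ.φ Φ.types 1 (…)`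
# (stmt-g14's `KS.RPa`, `KS.hR'_at`) serves p1-g11's kit clauses in EITHER orientation of the long / kit pair (`hR'` for `φL = oriφ Φ.φ oL`).

builds on p205010 (kernel theorem, internal audit signed; external expert review pending) — nothing in this file uses p205010; nothing here is a claim about the open node.
Lane `prim-bschramm`, seat `prim-bschramm-p3` (gen 9; design owner + (R) owner); helper file (`--supports stmt-CriticalPhenomena-4575 --as helper`).
[cite: KozmaNitzan2024, §4 Lemma 10 Step IV (p. 20)] [folklore]
-/

noncomputable section

namespace Summit.CriticalPhenomena.PercolationContinuityZ3.Theorems.Transplant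

namespace Skelφ

open SimpleGraph Literature.Probability.Percolation Literature.Probability.LatticeModels
open scoped Classical

variable {V : Type} {G : SimpleGraph V} [G.LocallyFinite]

omit [G.LocallyFinite] in
/-- The summand of `cylRad` depends on the cylinder only through the SET. [folklore] -/
theorem cylRad_term_congr {s s' : Set V} (hs : s = s') {t : V} (ht : t ∈ s) (ht' : t ∈ s') (w : V) :
    (if h : w ∈ s then (G.induce s).dist ⟨t, ht⟩ ⟨w, h⟩ else 0) = (if h : w ∈ s' then (G.induce s').dist ⟨t, ht'⟩ ⟨w, h⟩ else 0) := by
  subst hs; rfl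

/-- **`cylRad` of the transposed map equals `cylRad`.** [folklore] -/
theorem cylRad_trφ (φ : V → Site 2) (t : V) (ℓ ψ : ℕ) : cylRad G (trφ φ) t ℓ ψ = cylRad G φ t ℓ ψ := by
  unfold cylRad
  refine Finset.sup_congr rfl fun w _ => ?_
  exact cylRad_term_congr (cyl_trφ φ t ℓ) _ _ w

/-- **`cylRadMax` of the transposed map equals `cylRadMax`.** [folklore] -/
theorem cylRadMax_trφ (φ : V → Site 2) (types : Finset V) (ℓ ψ : ℕ) : cylRadMax G (trφ φ) types ℓ ψ = cylRadMax G φ types ℓ ψ := by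
  unfold cylRadMax
  exact Finset.sup_congr rfl fun t _ => cylRad_trφ φ t ℓ ψ

/-- **`cylRadMax` of any oriented map equals `cylRadMax`.** [folklore] -/
theorem cylRadMax_oriφ (φ : V → Site 2) (b : Bool) (types : Finset V) (ℓ ψ : ℕ) : cylRadMax G (oriφ φ b) types ℓ ψ = cylRadMax G φ types ℓ ψ := by
  cases b
  · rw [oriφ_false]; exact cylRadMax_trφ φ types ℓ ψ
  · rw [oriφ_true]

omit [G.LocallyFinite] in
/-- **Frames of any oriented map** from frames of `φ`. [folklore] -/
theorem frames_oriφ {φ : V → Site 2} {types : Finset V} (h : Frames G φ types) (b : Bool) : Frames G (oriφ φ b) types := by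
  cases b
  · rw [oriφ_false]; exact frames_trφ h
  · rw [oriφ_true]; exact h

omit [G.LocallyFinite] in
/-- **Connected cylinders of any oriented map** from those of `φ`. [folklore] -/
theorem cylConn_oriφ {φ : V → Site 2} {types : Finset V} (h : CylConn G φ types) (b : Bool) : CylConn G (oriφ φ b) types := by
  cases b
  · rw [oriφ_false]; exact cylConn_trφ h
  · rw [oriφ_true]; exact h

end Skelφ

end Summit.CriticalPhenomena.PercolationContinuityZ3.Theorems.Transplant

end
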